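import Summits.ValiantsHypothesis.ValiantsHypothesis.Theorems.NewtonUnitEquationsTwoProductsMomentRecordLiftWronskian
import Summits.ValiantsHypothesis.ValiantsHypothesis.Theorems.NewtonUnitEquationsTwoProductsMomentRecordLiftModel
import Summits.ValiantsHypothesis.ValiantsHypothesis.Theorems.TwoProducts.Negative.CommonPadding

/-!
# R12 lift toolkit — class-sum identity and the data of an instance

(4/5) Linear forms `linForm α β j = Σ_i (α j i·y_i + β j i·y_i z)`, the CLASS-SUM IDENTITY `[E] Σ_j R_j^r = 𝟙[|S_E| = r]·(r!/ΠS_i!)·[z^{E(z)}] momentPoly α β S_E` (multinomial theorem over `ψ : ℂ[z] → ℂ[y,z]`), hence `[E] Λ_N = c_{|S_E|}·mult(S_E)·layer_{E(z)}(S_E)`; the DATA of an instance (`alphaOf`/`betaOf` = fibre sums of coefficients over the letter lift), `ellU j = linForm (alphaOf u) (betaOf u) j`, letters behind nonzero data, and TAMENESS of the lifted tails for a valid weight.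
Helper on crux `stmt-ValiantsHypothesis-5906` (line `relation_ladder`, R12 «moment record law», crit-8 g2's texts ✓ `…MomentRecordDefs` / `…MomentRecordRungDefs`); `--supports`, closes nothing by itself: (A∘) `MomentRecordLawUsed`, the rung (B), `PlanarCellBound` and the crux stay OPEN; VP ≠ VNP is NOT proved.  No instances, no notation, no named facts. [folklore]
-/

set_option linter.dupNamespace false

noncomputable section

open Classical

namespace Summit.ValiantsHypothesis.ValiantsHypothesis.Theorems.NewtonUnitEquations.TwoProducts.MomentRecord.Lift
open scoped BigOperators
open MvPolynomial

section ClassSumFile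

/-! ## Linear forms, the data of the instance, and the class-sum identity -/

section ClassSum
open Summit.ValiantsHypothesis.ValiantsHypothesis.Theorems.NewtonUnitEquations.TwoProducts.FormalLogLinearisation
open Summit.ValiantsHypothesis.ValiantsHypothesis.Theorems.NewtonUnitEquations.TwoProducts.PlanarCell
open Summit.ValiantsHypothesis.ValiantsHypothesis.Theorems.NewtonUnitEquations.TwoProducts.MomentRecord

variable {m n : ℕ}

/-- The LINEAR FORM of a data row: `R_j = Σ_i (α j i · y_i + β j i · y_i z)`. [folklore] -/
def linForm (α β : Fin m → Fin n → ℂ) (j : Fin m) : MvPolynomial (Option (Fin n)) ℂ :=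
  ∑ i, (monomial (yExp i) (α j i) + monomial (yzExp i) (β j i))

/-- The pencil entry `α + z β` as a univariate polynomial (the summand base of the landed `momentPoly`). [folklore] -/
def pencilPoly (α β : Fin m → Fin n → ℂ) (j : Fin m) (i : Fin n) : Polynomial ℂ :=
  Polynomial.C (α j i) + Polynomial.X * Polynomial.C (β j i)

/-- The embedding `ℂ[z] → ℂ[y, z]`, `z ↦ X none`. [folklore] -/
def psiZ (n : ℕ) : Polynomial ℂ →ₐ[ℂ] MvPolynomial (Option (Fin n)) ℂ :=
  Polynomial.aeval (X none)

/-- `α·y_i + β·y_i z = y_i · ψ(α + z β)`. [folklore] -/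
theorem monomial_yExp_add_yzExp (α β : Fin m → Fin n → ℂ) (j : Fin m) (i : Fin n) :
    (monomial (yExp i) (α j i) + monomial (yzExp i) (β j i) : MvPolynomial (Option (Fin n)) ℂ) =
      X (some i) * psiZ n (pencilPoly α β j i) := by
  rw [psiZ, pencilPoly, map_add, map_mul, Polynomial.aeval_C, Polynomial.aeval_C, Polynomial.aeval_X, MvPolynomial.algebraMap_eq,
    show X (some i) * (C (α j i) + X none * C (β j i)) = C (α j i) * X (some i) + C (β j i) * (X (some i) * X none) by ring,
    C_mul_X_eq_monomial, X, X, monomial_mul, C_mul_monomial, mul_one, mul_one]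
  rfl

/-- The carrier part of an upstairs exponent as an exponent: `Σ_i k_i • y_i`. [folklore] -/
def embS (k : Fin n → ℕ) : Option (Fin n) →₀ ℕ := ∑ i, Finsupp.single (some i) (k i)

/-- Coordinates of `embS k + t • z`. [folklore] -/
theorem embS_add_single_apply (k : Fin n → ℕ) (t : ℕ) (w : Option (Fin n)) :
    (embS k + Finsupp.single none t : Option (Fin n) →₀ ℕ) w = Option.elim w t k := by
  classical
  rw [Finsupp.add_apply, embS, Finsupp.finsetSum_apply]
  cases w with
  | none => simp
  | some i =>
    rw [Finset.sum_eq_single i (fun j _ hj => by simp [hj]) (by simp)]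
    simp

/-- `embS k + t • z = E` iff `E` has carrier part `k` and `z`-degree `t`. [folklore] -/
theorem embS_add_single_eq_iff (k : Fin n → ℕ) (t : ℕ) (E : Option (Fin n) →₀ ℕ) :
    embS k + Finsupp.single none t = E ↔ (∀ i, E (some i) = k i) ∧ E none = t := by
  constructor
  · rintro rfl
    exact ⟨fun i => by rw [embS_add_single_apply]; rfl, by rw [embS_add_single_apply]; rfl⟩
  · rintro ⟨h1, h2⟩
    ext w
    rw [embS_add_single_apply]
    cases w with
    | none => exact h2.symm
    | some i => exact (h1 i).symm

/-- `∏_i y_i^{k_i} = Y^{embS k}`. [folklore] -/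
theorem prod_X_pow_eq_monomial_embS (k : Fin n → ℕ) :
    ∏ i, (X (some i) : MvPolynomial (Option (Fin n)) ℂ) ^ k i = monomial (embS k) 1 := by
  rw [embS, monomial_sum_index, C_1, one_mul]
  exact Finset.prod_congr rfl fun i _ => X_pow_eq_monomial

/-- The embedding `ψ` as a sum of `z`-monomials. [folklore] -/
theorem psiZ_eq_sum (P : Polynomial ℂ) :
    psiZ n P = ∑ t ∈ Finset.range (P.natDegree + 1), monomial (Finsupp.single none t) (P.coeff t) := by
  rw [psiZ, Polynomial.aeval_eq_sum_range]
  refine Finset.sum_congr rfl fun t _ => ?_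
  rw [X_pow_eq_monomial, smul_monomial, smul_eq_mul, mul_one]

/-- **Key coefficient lemma.** `[E] (Y^{embS k} · ψ P) = P_{E(z)}` if `E` has carrier part `k`, else `0`. [folklore] -/
theorem coeff_monomial_embS_mul_psiZ (k : Fin n → ℕ) (P : Polynomial ℂ) (E : Option (Fin n) →₀ ℕ) :
    coeff E (monomial (embS k) (1 : ℂ) * psiZ n P) = if (∀ i, E (some i) = k i) then P.coeff (E none) else 0 := by
  classical
  rw [psiZ_eq_sum, Finset.mul_sum, coeff_sum]
  simp_rw [monomial_mul, one_mul, coeff_monomial]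
  by_cases hk : ∀ i, E (some i) = k i
  · rw [if_pos hk]
    have h : ∀ t ∈ Finset.range (P.natDegree + 1),
        (if embS k + Finsupp.single none t = E then P.coeff t else 0) = if E none = t then P.coeff t else 0 := by
      intro t _
      congr 1
      rw [embS_add_single_eq_iff]
      exact propext ⟨fun h => h.2, fun h => ⟨hk, h⟩⟩
    rw [Finset.sum_congr rfl h, Finset.sum_ite_eq]
    split_ifs with hmem
    · rfl
    · rw [Finset.mem_range, not_lt] at hmem
      exact (Polynomial.coeff_eq_zero_of_natDegree_lt (by omega)).symm
  · rw [if_neg hk]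
    refine Finset.sum_eq_zero fun t _ => ?_
    rw [if_neg]
    rw [embS_add_single_eq_iff]
    exact fun h => hk h.1

/-- **THE CLASS-SUM IDENTITY** for one row: `[E] R_j^r = 𝟙[|S_E| = r] · (r!/Π S_i!) · [z^{E(z)}] Π_i (α j i + z β j i)^{S_E i}`. [folklore] -/
theorem coeff_linForm_pow (α β : Fin m → Fin n → ℂ) (j : Fin m) (r : ℕ) (E : Option (Fin n) →₀ ℕ) :
    coeff E (linForm α β j ^ r) =
      if ydeg E = r then (Nat.multinomial Finset.univ (fun i => E (some i)) : ℂ) *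
        (∏ i, pencilPoly α β j i ^ E (some i)).coeff (E none) else 0 := by
  classical
  have hlin : linForm α β j = ∑ i, X (some i) * psiZ n (pencilPoly α β j i) :=
    Finset.sum_congr rfl fun i _ => monomial_yExp_add_yzExp α β j i
  rw [hlin, Finset.sum_pow_eq_sum_piAntidiag, coeff_sum]
  have hterm : ∀ k ∈ Finset.univ.piAntidiag r,
      coeff E ((Nat.multinomial Finset.univ k : MvPolynomial (Option (Fin n)) ℂ) *
          ∏ i, (X (some i) * psiZ n (pencilPoly α β j i)) ^ k i) =
        if (fun i => E (some i)) = k then (Nat.multinomial Finset.univ k : ℂ) * (∏ i, pencilPoly α β j i ^ k i).coeff (E none)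
        else 0 := by
    intro k _
    rw [← map_natCast (C : ℂ →+* MvPolynomial (Option (Fin n)) ℂ), coeff_C_mul]
    simp_rw [mul_pow]
    rw [Finset.prod_mul_distrib, prod_X_pow_eq_monomial_embS]
    simp_rw [← map_pow]
    rw [← map_prod, coeff_monomial_embS_mul_psiZ]
    by_cases h : (fun i => E (some i)) = k
    · rw [if_pos h, if_pos (fun i => congr_fun h i)]
    · rw [if_neg h, if_neg (fun h' => h (funext h')), mul_zero]
  rw [Finset.sum_congr rfl hterm, Finset.sum_ite_eq]
  have hmem : (fun i => E (some i)) ∈ Finset.univ.piAntidiag r ↔ ydeg E = r := by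
    rw [Finset.mem_piAntidiag]
    simp [ydeg]
  by_cases hr : ydeg E = r
  · rw [if_pos (hmem.mpr hr), if_pos hr]
  · rw [if_neg (fun h => hr (hmem.mp h)), if_neg hr]

/-- `momentPoly` is the row sum of the pencil products. [folklore] -/
theorem momentPoly_eq_sum_prod_pencilPoly (α β : Fin m → Fin n → ℂ) (S : Fin n → ℕ) :
    momentPoly α β S = ∑ j, ∏ i, pencilPoly α β j i ^ S i := rfl

/-- The class-sum identity summed over the rows: `[E] Σ_j R_j^r = 𝟙[|S_E| = r] · mult(S_E) · [z^{E(z)}] momentPoly α β S_E`. [folklore] -/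
theorem coeff_sum_linForm_pow (α β : Fin m → Fin n → ℂ) (r : ℕ) (E : Option (Fin n) →₀ ℕ) :
    coeff E (∑ j, linForm α β j ^ r) =
      if ydeg E = r then (Nat.multinomial Finset.univ (fun i => E (some i)) : ℂ) *
        (momentPoly α β fun i => E (some i)).coeff (E none) else 0 := by
  rw [coeff_sum]
  simp_rw [coeff_linForm_pow]
  split_ifs with h
  · rw [momentPoly_eq_sum_prod_pencilPoly, Polynomial.finsetSum_coeff, Finset.mul_sum]
  · simp

/-- Coefficients of the truncated log-sum of the rows: `[E] Σ_j log_N(1+R_j) = c_{|S_E|} · mult(S_E) · [z^{E(z)}] momentPoly` for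
`1 ≤ |S_E| ≤ N`, else `0`. [folklore] -/
theorem coeff_sum_logT_linForm (α β : Fin m → Fin n → ℂ) (N : ℕ) (E : Option (Fin n) →₀ ℕ) :
    coeff E (∑ j, logT N (linForm α β j)) =
      if 1 ≤ ydeg E ∧ ydeg E ≤ N then ((-1 : ℂ) ^ (ydeg E + 1) / (ydeg E : ℂ)) *
        ((Nat.multinomial Finset.univ (fun i => E (some i)) : ℂ) * (momentPoly α β fun i => E (some i)).coeff (E none)) else 0 := by
  classical
  have h : ∑ j, logT N (linForm α β j) = ∑ r ∈ Finset.Icc 1 N, ((-1 : ℂ) ^ (r + 1) / (r : ℂ)) • ∑ j, linForm α β j ^ r := by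
    unfold logT
    rw [Finset.sum_comm]
    refine Finset.sum_congr rfl fun r _ => ?_
    rw [Finset.smul_sum]
  rw [h, coeff_sum]
  simp_rw [coeff_smul, coeff_sum_linForm_pow, smul_eq_mul, mul_ite, mul_zero]
  rw [Finset.sum_ite_eq]
  simp only [Finset.mem_Icc]

/-- **Coefficients of the upstairs log-sum `Λ_N` are the LAYERS**:
`[E] (Σ_j log_N(1+R_j) − Σ_j log_N(1+R'_j)) = c_{|S_E|} · mult(S_E) · layer_{E(z)}(S_E)` for `1 ≤ |S_E| ≤ N`. [folklore] -/
theorem coeff_logSum_linForm_sub (α β α' β' : Fin m → Fin n → ℂ) (N : ℕ) (E : Option (Fin n) →₀ ℕ) :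
    coeff E (∑ j, logT N (linForm α β j) - ∑ j, logT N (linForm α' β' j)) =
      if 1 ≤ ydeg E ∧ ydeg E ≤ N then ((-1 : ℂ) ^ (ydeg E + 1) / (ydeg E : ℂ)) *
        (Nat.multinomial Finset.univ (fun i => E (some i)) : ℂ) * layer α β α' β' (E none) (fun i => E (some i)) else 0 := by
  rw [coeff_sub, coeff_sum_logT_linForm, coeff_sum_logT_linForm, layer, Polynomial.coeff_sub]
  split_ifs <;> ring

/-- The constant `c_{|S|} · mult(S)` is nonzero for `|S| ≥ 1`. [folklore] -/
theorem classConst_ne_zero {E : Option (Fin n) →₀ ℕ} (hE : 1 ≤ ydeg E) :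
    ((-1 : ℂ) ^ (ydeg E + 1) / (ydeg E : ℂ)) * (Nat.multinomial Finset.univ (fun i => E (some i)) : ℂ) ≠ 0 := by
  refine mul_ne_zero (div_ne_zero (pow_ne_zero _ (by norm_num)) ?_) ?_
  · exact_mod_cast (by omega : ydeg E ≠ 0)
  · exact_mod_cast (Nat.multinomial_pos _ _).ne'

end ClassSum

/-! ## The data of the instance, negativity of used letters, tameness -/

section Data
open Summit.ValiantsHypothesis.ValiantsHypothesis.Theorems.NewtonUnitEquations.TwoProducts.FormalLogLinearisation
open Summit.ValiantsHypothesis.ValiantsHypothesis.Theorems.NewtonUnitEquations.TwoProducts.PlanarCell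
open Summit.ValiantsHypothesis.ValiantsHypothesis.Theorems.NewtonUnitEquations.TwoProducts.MomentRecord
open Summit.ValiantsHypothesis.Theorems.TwoProducts.Negative.CommonPadding (wt_neg_of_mem_tailSupport)

variable {m n : ℕ}
variable (u v : Fin m → MvPolynomial (Fin 2) ℂ) (x : Fin n → Expo) (d : Fin 2 → ℤ)

/-- The BASE data of the tails `w` (= `u` or `v`): `α j i = Σ_{e : λ e = y_i} [e] w_j` (the coefficient of the letter `x_i`). [folklore] -/
def alphaOf (w : Fin m → MvPolynomial (Fin 2) ℂ) (j : Fin m) (i : Fin n) : ℂ :=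
  ∑ e ∈ (tailSupport u v).filter (fun e => lam u v x d e = yExp i), coeff e (w j)

/-- The SHIFT data of the tails `w`: `β j i = Σ_{e : λ e = y_i z} [e] w_j` (the coefficient of the letter `x_i + d`). [folklore] -/
def betaOf (w : Fin m → MvPolynomial (Fin 2) ℂ) (j : Fin m) (i : Fin n) : ℂ :=
  ∑ e ∈ (tailSupport u v).filter (fun e => lam u v x d e = yzExp i), coeff e (w j)

variable {u v x d}

/-- `yExp` is injective. [folklore] -/
theorem yExp_injective : Function.Injective (yExp (n := n)) := by
  intro i i' h
  have := congrArg (fun E : Option (Fin n) →₀ ℕ => E (some i)) h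
  simp only [yExp, Finsupp.single_apply] at this
  by_contra hne
  rw [if_neg (fun h' => hne (Option.some_injective _ h').symm)] at this
  exact one_ne_zero this

/-- `yzExp` is injective. [folklore] -/
theorem yzExp_injective : Function.Injective (yzExp (n := n)) := by
  intro i i' h
  have h' : yExp i = yExp i' := by
    have := congrArg (fun E : Option (Fin n) →₀ ℕ => E - Finsupp.single none 1) h
    simpa [yzExp, yExp] using this
  exact yExp_injective h'

/-- Carrier letters and shifted letters have different exponents. [folklore] -/
theorem yExp_ne_yzExp (i i' : Fin n) : yExp i ≠ yzExp i' := by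
  intro h
  have := congrArg (fun E : Option (Fin n) →₀ ℕ => E none) h
  simp [yExp, yzExp] at this

/-- **The lifted tail is the linear form of its data**: `ℓ_w j = Σ_i (α j i · y_i + β j i · y_i z)`. [folklore] -/
theorem liftW_lam_eq_linForm (halph : ∀ e ∈ tailSupport u v, ∃ i, e = x i ∨ ∀ c, ((e c : ℕ) : ℤ) = shiftZ x d i c)
    (w : Fin m → MvPolynomial (Fin 2) ℂ) (j : Fin m) (hw : (w j).support ⊆ tailSupport u v) :
    liftW (lam u v x d) (w j) = linForm (alphaOf u v x d w) (betaOf u v x d w) j := by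
  classical
  set L := tailSupport u v with hL
  have h1 : liftW (lam u v x d) (w j) = ∑ e ∈ L, monomial (lam u v x d e) (coeff e (w j)) := by
    rw [liftW]
    exact Finset.sum_subset hw fun e _ he => by rw [notMem_support_iff.1 he, map_zero]
  set T : Finset (Option (Fin n) →₀ ℕ) := Finset.univ.image yExp ∪ Finset.univ.image yzExp with hT
  have hmaps : ∀ e ∈ L, lam u v x d e ∈ T := by
    intro e he
    obtain ⟨i, hi | hi⟩ := isLetterExp_lam halph he
    · exact Finset.mem_union_left _ (Finset.mem_image.mpr ⟨i, Finset.mem_univ _, hi.1.symm⟩)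
    · exact Finset.mem_union_right _ (Finset.mem_image.mpr ⟨i, Finset.mem_univ _, hi.1.symm⟩)
  have h2 : ∑ e ∈ L, monomial (lam u v x d e) (coeff e (w j)) =
      ∑ E ∈ T, (monomial E (∑ e ∈ L.filter (fun e => lam u v x d e = E), coeff e (w j)) : MvPolynomial (Option (Fin n)) ℂ) := by
    rw [← Finset.sum_fiberwise_of_maps_to hmaps]
    refine Finset.sum_congr rfl fun E _ => ?_
    rw [map_sum]
    refine Finset.sum_congr rfl fun e he => ?_
    rw [(Finset.mem_filter.mp he).2]
  have hdisj : Disjoint (Finset.univ.image (yExp (n := n))) (Finset.univ.image yzExp) := by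
    rw [Finset.disjoint_left]
    intro E h1 h2
    obtain ⟨i, _, rfl⟩ := Finset.mem_image.mp h1
    obtain ⟨i', _, h⟩ := Finset.mem_image.mp h2
    exact yExp_ne_yzExp i i' h.symm
  rw [h1, h2, hT, Finset.sum_union hdisj, Finset.sum_image fun i _ i' _ h => yExp_injective h,
    Finset.sum_image fun i _ i' _ h => yzExp_injective h, linForm, Finset.sum_add_distrib]
  rfl

/-- The upstairs `u`-tails are the linear forms of the `u`-data. [folklore] -/
theorem ellU_eq_linForm (halph : ∀ e ∈ tailSupport u v, ∃ i, e = x i ∨ ∀ c, ((e c : ℕ) : ℤ) = shiftZ x d i c) (j : Fin m) :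
    ellU (u := u) (v := v) (x := x) (d := d) j = linForm (alphaOf u v x d u) (betaOf u v x d u) j :=
  liftW_lam_eq_linForm halph u j fun _ he => Finset.mem_union_left _ (Finset.mem_biUnion.mpr ⟨j, Finset.mem_univ _, he⟩)

/-- The upstairs `v`-tails are the linear forms of the `v`-data. [folklore] -/
theorem ellV_eq_linForm (halph : ∀ e ∈ tailSupport u v, ∃ i, e = x i ∨ ∀ c, ((e c : ℕ) : ℤ) = shiftZ x d i c) (j : Fin m) :
    ellV (u := u) (v := v) (x := x) (d := d) j = linForm (alphaOf u v x d v) (betaOf u v x d v) j :=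
  liftW_lam_eq_linForm halph v j fun _ he => Finset.mem_union_right _ (Finset.mem_biUnion.mpr ⟨j, Finset.mem_univ _, he⟩)

/-- A nonzero base datum comes from the letter `x_i` occurring in that tail. [folklore] -/
theorem exists_letter_of_alphaOf_ne_zero (hu : ∀ j, coeff 0 (u j) = 0) (hv : ∀ j, coeff 0 (v j) = 0)
    (halph : ∀ e ∈ tailSupport u v, ∃ i, e = x i ∨ ∀ c, ((e c : ℕ) : ℤ) = shiftZ x d i c)
    {w : Fin m → MvPolynomial (Fin 2) ℂ} {j : Fin m} {i : Fin n} (h : alphaOf u v x d w j i ≠ 0) :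
    x i ∈ (w j).support := by
  classical
  obtain ⟨e, he, hne⟩ := Finset.exists_ne_zero_of_sum_ne_zero h
  obtain ⟨heL, hlam⟩ := Finset.mem_filter.mp he
  have hpt := pt_lam hu hv halph (Finset.mem_insert_of_mem heL) (x := x) (d := d)
  rw [hlam, pt_yExp] at hpt
  rw [ιZ_injective hpt]
  exact mem_support_iff.mpr hne

/-- A nonzero shift datum comes from the letter `x_i + d` occurring in that tail. [folklore] -/
theorem exists_letter_of_betaOf_ne_zero (hu : ∀ j, coeff 0 (u j) = 0) (hv : ∀ j, coeff 0 (v j) = 0)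
    (halph : ∀ e ∈ tailSupport u v, ∃ i, e = x i ∨ ∀ c, ((e c : ℕ) : ℤ) = shiftZ x d i c)
    {w : Fin m → MvPolynomial (Fin 2) ℂ} {j : Fin m} {i : Fin n} (h : betaOf u v x d w j i ≠ 0) :
    ∃ e ∈ (w j).support, ιZ e = shiftZ x d i := by
  classical
  obtain ⟨e, he, hne⟩ := Finset.exists_ne_zero_of_sum_ne_zero h
  obtain ⟨heL, hlam⟩ := Finset.mem_filter.mp he
  have hpt := pt_lam hu hv halph (Finset.mem_insert_of_mem heL) (x := x) (d := d)
  rw [hlam, pt_yzExp] at hpt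
  exact ⟨e, mem_support_iff.mpr hne, hpt.symm⟩

/-- Total degree of an upstairs exponent: letters plus shifts. [folklore] -/
theorem degree_eq_ydeg_add (E : Option (Fin n) →₀ ℕ) : E.degree = ydeg E + E none := by
  rw [Finsupp.degree_eq_sum, Fintype.sum_option, ydeg, add_comm]

/-- **Tameness of the lifted tails** for the model weight of a valid `ξ`: with `c = min_e (−wt ξ e)/2 > 0` over the tail letters,
every monomial `λ e` of a lifted tail has weight `wt ξ e ≤ −c · deg(λ e)` (degree `≤ 2`). [folklore] -/
theorem exists_tame_liftW
    (halph : ∀ e ∈ tailSupport u v, ∃ i, e = x i ∨ ∀ c, ((e c : ℕ) : ℤ) = shiftZ x d i c) {ξ : Fin 2 → ℝ}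
    (hval : ValidWeight u v ξ) :
    ∃ c : ℝ, 0 < c ∧ ∀ (w : Fin m → MvPolynomial (Fin 2) ℂ) (j : Fin m), (w j).support ⊆ tailSupport u v →
      Tame (κw ξ x d) c (liftW (lam u v x d) (w j)) := by
  classical
  set L := tailSupport u v with hL
  by_cases hne : L.Nonempty
  · set c := (L.image fun e => - wt ξ e / 2).min' (hne.image _) with hc
    have hcpos : 0 < c := by
      rw [hc, Finset.lt_min'_iff]
      intro y hy
      obtain ⟨e, he, rfl⟩ := Finset.mem_image.mp hy
      have := wt_neg_of_mem_tailSupport hval he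
      linarith
    have hcle : ∀ e ∈ L, c ≤ - wt ξ e / 2 := fun e he =>
      Finset.min'_le _ _ (Finset.mem_image.mpr ⟨e, he, rfl⟩)
    refine ⟨c, hcpos, fun w j hw E hE => ?_⟩
    -- `E` is a monomial of a sum of letter monomials
    rw [liftW] at hE
    obtain ⟨e, he, hEe⟩ : ∃ e ∈ (w j).support, E ∈ (monomial (lam u v x d e) (coeff e (w j))).support := by
      by_contra h
      push Not at h
      have : E ∉ (∑ e ∈ (w j).support, monomial (lam u v x d e) (coeff e (w j))).support := by
        intro hmem
        obtain ⟨e, he, hEe⟩ := Finset.mem_biUnion.mp (support_sum hmem)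
        exact h e he hEe
      exact this hE
    have hEeq : E = lam u v x d e := by
      rw [support_monomial] at hEe
      split_ifs at hEe with h0
      · simp at hEe
      · exact Finset.mem_singleton.mp hEe
    have heL : e ∈ L := hw he
    obtain ⟨hpt, hyd, hk⟩ := (isLetterExp_lam halph heL).pt_eq (x := x) (d := d)
    rw [hEeq, lw_κw, hpt, wtZ_ιZ, degree_eq_ydeg_add, hyd]
    have h2 : ((1 + (lam u v x d e) none : ℕ) : ℝ) ≤ 2 := by exact_mod_cast (by omega : 1 + (lam u v x d e) none ≤ 2)
    have := hcle e heL
    nlinarith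
  · refine ⟨1, one_pos, fun w j hw E hE => ?_⟩
    exfalso
    rw [Finset.not_nonempty_iff_eq_empty] at hne
    have hsupp : (w j).support = ∅ := Finset.subset_empty.mp (hne ▸ hw)
    rw [liftW, hsupp, Finset.sum_empty, support_zero] at hE
    simp at hE

end Data

end ClassSumFile

end Summit.ValiantsHypothesis.ValiantsHypothesis.Theorems.NewtonUnitEquations.TwoProducts.MomentRecord.Lift

end
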